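import Summits.NavierStokesRegularity.FunctionalMining.TopEigLaminateTwo
import Summits.NavierStokesRegularity.FunctionalMining.PlaneShearTopEig
import HarnessLib

/-!
# FunctionalMining — LAMINATE RIGIDITY for Lemma L-λ(2), general form: every laminate
# `u(x) = A(k·x)` (`k ∈ ℤ³∖{0}`, any polarisation `A : ℝ → ℝ³` with `k·A′ ≡ 0`) has
# `heatDissipation (∫(λ₁⁺)²) u = ½|k|⁴∫₀¹|A″|² ≥ 8π²|k|² · ∫(λ₁⁺)²(u)`

Search for candidate a priori estimates; no regularity claim. Cell `pub-nsfunc`, prove seat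
(gen 19). Kernel form of the no-go seat's laminate rigidity lemma `SIEVELD.md` §3.4b (4b)(i) ("for a
one-dimensional profile `u = A(ν·x)` (`A ⊥ ν`, any polarisation) … `R₂ = 2‖A″‖²/‖A′‖² ≥ 2`"), for every
LATTICE direction `k` and every polarisation; `TopEigLaminateTwo` is the special case `k = e₂`,
`A = (F, 0, 0)`. Static calculus of explicit smooth fields; nothing about Navier–Stokes dynamics.

For `k : Fin 3 → ℤ`, `k ≠ 0`, and three smooth `1`-periodic profiles `A = (A₀, A₁, A₂)` with
`∑ᵢ kᵢ Aᵢ′ ≡ 0` (divergence free), `lamV k A (x) = (A₀(k·x), A₁(k·x), A₂(k·x))`: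
* `lamV` is smooth and divergence free, `∂ⱼu = kⱼ·u_{A′}`, `Δu = |k|²·u_{A″}`; the strain of every
  point of the heat line is the PLANE SHEAR `sym(a⊗k)`, `a = A′(k·x) + t|k|²A‴(k·x) ⊥ k`
  (`strainFlat_line`), so `λ(±S)² = |a|²|k|²/4` (`TopEig.lam_shearT_sq`) and
  `∫(λ₁⁺)²(u + tΔu) = (|k|²/4)(Φ₀ + 2t|k|²Φ₁ + t²|k|⁴Φ₂)`, `Φ₀ = ∫₀¹|A′|²`, `Φ₁ = ∫₀¹A′·A‴ = −∫₀¹|A″|²`,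
  `Φ₂ = ∫₀¹|A‴|²` (Lemma D; `topEigMoment_two_line_V`);
* **`heatDissipation_topEigMoment_two_lamV : heatDissipation (∫(λ₁⁺)²) u = ½|k|⁴ ∫₀¹|A″|²`**,
  `∫(λ₁⁺)²(u) = ¼|k|²∫₀¹|A′|²`;
* **`laminate_rigid_two_V : 8π²·|k|²·∫(λ₁⁺)²(u) ≤ heatDissipation (∫(λ₁⁺)²) u`** (sharp Wirtinger on each
  coordinate profile, `ProfileWirtinger.wirtinger_D`), hence `8π²·∫(λ₁⁺)²(u) ≤ heatDissipation` since
  `|k|² ≥ 1`; the same for the `−λ₃` core; class form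
  **`heatCoerciveOn_isLaminate_two : HeatCoerciveOn IsLaminate (∫(λ₁⁺)²) (8π²)`**.
So `R₂ ≥ 2·4π²|k|²` on every laminate: one-dimensional structure is optimally stiff at `q = 2`
(contrast `TopEigLaminateFour`: not at `q = 4`). [ours, calibration]
-/

noncomputable section

open MeasureTheory Set intervalIntegral

namespace Summit.NavierStokesRegularity.FunctionalMining
open Literature.Analysis Literature.Analysis.FunctionSpaces Literature.Analysis.FunctionSpaces.Torus
open TopEig StrainL4 LaminateDirection

namespace TopEigLaminate

variable (k : Fin 3 → ℤ) (A : Fin 3 → ShearProfile)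

/-! ## 1. The general laminate `u(x) = A(k·x)` -/

/-- The real direction vector `κ = (k₀, k₁, k₂) ∈ ℝ³`. [ours; bookkeeping] -/
def kR : Fin 3 → ℝ := fun j => (k j : ℝ)

/-- `|k|² = κ·κ`. [ours; bookkeeping] -/
theorem kR_dot : kR k ⬝ᵥ kR k = ∑ j, (k j : ℝ) ^ 2 := by simp [kR, dotProduct, sq]

/-- `|k|² ≥ 1` for a nonzero lattice vector. [folklore] -/
theorem one_le_kR_dot (hk : k ≠ 0) : 1 ≤ kR k ⬝ᵥ kR k := by
  rw [kR_dot]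
  obtain ⟨j, hj⟩ : ∃ j, k j ≠ 0 := by by_contra h; push Not at h; exact hk (funext h)
  have h1 : (1 : ℝ) ≤ (k j : ℝ) ^ 2 := by
    have : (1 : ℤ) ≤ k j ^ 2 := by nlinarith [Int.one_le_abs hj, sq_abs (k j)]
    exact_mod_cast this
  exact h1.trans (Finset.single_le_sum (fun i _ => sq_nonneg ((k i : ℝ))) (Finset.mem_univ j))

/-- Componentwise derived profiles `A′ = (A₀′, A₁′, A₂′)`. [ours; bookkeeping] -/
def DA : Fin 3 → ShearProfile := fun i => (A i).D

/-- **The laminate `u(x) = (A₀(k·x), A₁(k·x), A₂(k·x))`.** Search for candidate a priori estimates; no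
regularity claim. [ours] -/
def lamV (x : UnitAddTorus (Fin 3)) : EuclideanSpace ℝ (Fin 3) :=
  dirFun k (A 0) x • EuclideanSpace.single 0 (1 : ℝ) + dirFun k (A 1) x • EuclideanSpace.single 1 (1 : ℝ) +
    dirFun k (A 2) x • EuclideanSpace.single 2 (1 : ℝ)

/-- Coordinates of `lamV`. [ours; bookkeeping] -/
@[simp] theorem lamV_apply (x : UnitAddTorus (Fin 3)) (i : Fin 3) : lamV k A x i = dirFun k (A i) x := by
  fin_cases i <;> simp [lamV]

/-- `lamV` is smooth. [ours] -/
theorem isSmooth_lamV : IsSmooth (lamV k A) :=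
  (((isSmooth_dirFun k (A 0)).smul' (isSmooth_const _)).add ((isSmooth_dirFun k (A 1)).smul'
    (isSmooth_const _))).add ((isSmooth_dirFun k (A 2)).smul' (isSmooth_const _))

/-- `lamV` is `C¹`. [ours; bookkeeping] -/
theorem isContDiff_lamV : IsContDiff 1 (lamV k A) := (isSmooth_lamV k A).isContDiff (by simp)

/-- Coordinates of the gradient: `(∂ⱼu)ᵢ = kⱼ Aᵢ′(k·x)`. [ours] -/
theorem partialDeriv_lamV_apply (j : Fin 3) (x : UnitAddTorus (Fin 3)) (i : Fin 3) :
    Torus.partialDeriv j (lamV k A) x i = (k j : ℝ) * dirFun k (DA A i) x := by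
  rw [← partialDeriv_apply_coord (isContDiff_lamV k A) j x i]
  have h : (fun y => lamV k A y i) = dirFun k (A i) := funext fun y => lamV_apply k A y i
  rw [h, partialDeriv_dirFun]
  rfl

/-- **`∂ⱼ u_A = kⱼ · u_{A′}`** (function level). [ours] -/
theorem partialDeriv_lamV (j : Fin 3) :
    Torus.partialDeriv j (lamV k A) = (k j : ℝ) • lamV k (DA A) := by
  funext x; ext i
  rw [partialDeriv_lamV_apply, Pi.smul_apply, PiLp.smul_apply, smul_eq_mul, lamV_apply]

/-- **`Δ u_A = |k|² · u_{A″}`.** [ours] -/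
theorem laplacian_lamV : Torus.laplacian (lamV k A) = (kR k ⬝ᵥ kR k) • lamV k (DA (DA A)) := by
  funext x
  rw [laplacian_eq_sum_partialDeriv_partialDeriv (isSmooth_lamV k A), Fin.sum_univ_three]
  have h : ∀ j : Fin 3, Torus.partialDeriv j (Torus.partialDeriv j (lamV k A)) =
      (k j : ℝ) • ((k j : ℝ) • lamV k (DA (DA A))) := by
    intro j
    rw [partialDeriv_lamV, partialDeriv_const_smul (isContDiff_lamV k (DA A)), partialDeriv_lamV]
  rw [h, h, h, kR_dot, Fin.sum_univ_three]
  simp only [Pi.smul_apply, smul_smul, ← add_smul]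
  congr 1; ring

variable {k A}

/-- **`u_A` is divergence free** when `∑ kᵢ Aᵢ′ ≡ 0`. [ours] -/
theorem isDivFree_lamV (hdiv : ∀ s : ℝ, ∑ i, (k i : ℝ) * (A i).D s = 0) : IsDivFree (lamV k A) := by
  intro x
  obtain ⟨t, ht⟩ := exists_dirFun_eq k x
  rw [divergence_eq_sum_partialDeriv_apply (isContDiff_lamV k A)]
  simp only [partialDeriv_lamV_apply, DA, ht]
  exact hdiv t

/-- Differentiating the divergence constraint: `∑ kᵢ Aᵢ″ ≡ 0` as well. [ours] -/
theorem sum_DD_eq_zero (hdiv : ∀ s : ℝ, ∑ i, (k i : ℝ) * (A i).D s = 0) (s : ℝ) :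
    ∑ i, (k i : ℝ) * (A i).D.D s = 0 := by
  have hd : ∀ (Q : ShearProfile) (x : ℝ), HasDerivAt (Q : ℝ → ℝ) (Q.D x) x := fun Q x =>
    ((Q.contDiff.differentiable (by simp)) x).hasDerivAt
  have h : HasDerivAt (fun s => ∑ i, (k i : ℝ) * (A i).D s) (∑ i, (k i : ℝ) * (A i).D.D s) s := by
    exact HasDerivAt.fun_sum fun i _ => (hd (A i).D s).const_mul (k i : ℝ)
  have h0 : HasDerivAt (fun s => ∑ i, (k i : ℝ) * (A i).D s) 0 s := by
    have e : (fun s => ∑ i, (k i : ℝ) * (A i).D s) = fun _ => 0 := funext hdiv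
    rw [e]; exact hasDerivAt_const s 0
  exact h.unique h0

/-! ## 2. The strain along the heat line is a plane shear `sym(a⊗k)` with `a ⊥ k` -/

/-- The profile vector `a(x) = A′(k·x)`. [ours; bookkeeping] -/
def aVec (B : Fin 3 → ShearProfile) (x : UnitAddTorus (Fin 3)) : Fin 3 → ℝ := fun i => dirFun k (DA B i) x

/-- The strain of `u_B` is `sym(B′(k·x) ⊗ k)`. [ours] -/
theorem strainFlat_lamV (B : Fin 3 → ShearProfile) (x : UnitAddTorus (Fin 3)) :
    strainFlat (lamV k B) x = shearT (aVec (k := k) B x) (kR k) := by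
  ext p
  obtain ⟨i, j⟩ := p
  simp only [strainFlat_apply, shearT_apply, partialDeriv_lamV_apply, aVec, kR]
  ring

/-- **Strain along the heat line**: `S(u + tΔu) = sym((A′ + t|k|²A‴)(k·x) ⊗ k)`. [ours] -/
theorem strainFlat_line (t : ℝ) (x : UnitAddTorus (Fin 3)) :
    strainFlat (lamV k A + t • Torus.laplacian (lamV k A)) x =
      shearT (aVec (k := k) A x + (t * (kR k ⬝ᵥ kR k)) • aVec (k := k) (DA (DA A)) x) (kR k) := by
  have hc : IsContDiff 1 ((kR k ⬝ᵥ kR k) • lamV k (DA (DA A))) := by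
    have h := isContDiff_lamV k (DA (DA A))
    unfold IsContDiff at h ⊢
    exact h.const_smul (kR k ⬝ᵥ kR k)
  rw [laplacian_lamV, strainFlat_add_smul (isContDiff_lamV k A) hc t x,
    strainFlat_smul (isContDiff_lamV k _), strainFlat_lamV, strainFlat_lamV, smul_smul, shearT_add_smul]

/-- The profile vector of the heat line is orthogonal to `k`. [ours] -/
theorem aVec_line_dot (hdiv : ∀ s : ℝ, ∑ i, (k i : ℝ) * (A i).D s = 0) (t : ℝ) (x : UnitAddTorus (Fin 3)) :
    (aVec (k := k) A x + (t * (kR k ⬝ᵥ kR k)) • aVec (k := k) (DA (DA A)) x) ⬝ᵥ kR k = 0 := by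
  obtain ⟨s, hs⟩ := exists_dirFun_eq k x
  have h1 : aVec (k := k) A x ⬝ᵥ kR k = 0 := by
    simp only [aVec, DA, dotProduct, kR, hs]
    rw [← hdiv s]
    exact Finset.sum_congr rfl fun i _ => by ring
  have h3 : aVec (k := k) (DA (DA A)) x ⬝ᵥ kR k = 0 := by
    simp only [aVec, DA, dotProduct, kR, hs]
    rw [← sum_DD_eq_zero (A := DA A) (fun r => sum_DD_eq_zero hdiv r) s]
    exact Finset.sum_congr rfl fun i _ => by simp only [DA]; ring
  rw [add_dotProduct, smul_dotProduct, h1, h3, smul_zero, add_zero]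

variable (A) in
/-- The profile density `|A′|²(s)`. [ours; bookkeeping] -/
def prof0 (s : ℝ) : ℝ := ∑ i, (A i).D s ^ 2
variable (A) in
/-- `A′·A‴`. [ours; bookkeeping] -/
def prof1 (s : ℝ) : ℝ := ∑ i, (A i).D s * (A i).D.D.D s
variable (A) in
/-- `|A‴|²`. [ours; bookkeeping] -/
def prof2 (s : ℝ) : ℝ := ∑ i, (A i).D.D.D s ^ 2
variable (A) in
/-- `|A″|²`. [ours; bookkeeping] -/
def profDD (s : ℝ) : ℝ := ∑ i, (A i).D.D s ^ 2

variable (k A) in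
/-- The density of `λ(±S(u + tΔu))²` as a function on the circle `y = k·x`:
`(m/4)(|A′|² + 2tm A′·A‴ + t²m² |A‴|²)(y)`, `m = |k|²`. [ours; bookkeeping] -/
def lineDensity (t : ℝ) (y : UnitAddCircle) : ℝ :=
  (kR k ⬝ᵥ kR k) / 4 * (∑ i, (A i).D.onCircle y ^ 2 +
    2 * (t * (kR k ⬝ᵥ kR k)) * ∑ i, (A i).D.onCircle y * (A i).D.D.D.onCircle y +
    (t * (kR k ⬝ᵥ kR k)) ^ 2 * ∑ i, (A i).D.D.D.onCircle y ^ 2)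

/-- The line density is continuous on the circle. [ours; bookkeeping] -/
theorem continuous_lineDensity (t : ℝ) : Continuous (lineDensity k A t) := by
  have hc : ∀ Q : ShearProfile, Continuous Q.onCircle := fun Q => Q.continuous_onCircle
  unfold lineDensity
  refine continuous_const.mul ((Continuous.add (Continuous.add ?_ ?_)) ?_)
  · exact continuous_finsetSum _ fun i _ => (hc _).pow 2
  · exact continuous_const.mul (continuous_finsetSum _ fun i _ => (hc _).mul (hc _))
  · exact continuous_const.mul (continuous_finsetSum _ fun i _ => (hc _).pow 2)

/-- The line density at a real representative. [ours; bookkeeping] -/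
theorem lineDensity_coe (t s : ℝ) :
    lineDensity k A t (s : UnitAddCircle) =
      (kR k ⬝ᵥ kR k) / 4 * (prof0 A s + 2 * (t * (kR k ⬝ᵥ kR k)) * prof1 A s +
        (t * (kR k ⬝ᵥ kR k)) ^ 2 * prof2 A s) := by
  simp only [lineDensity, prof0, prof1, prof2, ShearProfile.onCircle_coe]

/-- **`λ(±S(u + tΔu))(x)² = lineDensity t (k·x)`**, `λ(±S) ≥ 0`. [ours] -/
theorem lam_sq_line_V (hdiv : ∀ s : ℝ, ∑ i, (k i : ℝ) * (A i).D s = 0) (t : ℝ) (x : UnitAddTorus (Fin 3)) :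
    lam (strainFlat (lamV k A + t • Torus.laplacian (lamV k A)) x) ^ 2 = lineDensity k A t (dirForm k x) ∧
      lam (-strainFlat (lamV k A + t • Torus.laplacian (lamV k A)) x) ^ 2 = lineDensity k A t (dirForm k x) ∧
      0 ≤ lam (strainFlat (lamV k A + t • Torus.laplacian (lamV k A)) x) ∧
      0 ≤ lam (-strainFlat (lamV k A + t • Torus.laplacian (lamV k A)) x) := by
  rw [strainFlat_line]
  obtain ⟨h1, h2, h3, h4⟩ := lam_shearT_sq (aVec_line_dot hdiv t x)
  have hdot : (aVec (k := k) A x + (t * (kR k ⬝ᵥ kR k)) • aVec (k := k) (DA (DA A)) x) ⬝ᵥ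
      (aVec (k := k) A x + (t * (kR k ⬝ᵥ kR k)) • aVec (k := k) (DA (DA A)) x) * (kR k ⬝ᵥ kR k) / 4 =
      lineDensity k A t (dirForm k x) := by
    simp only [aVec, DA, dotProduct, Pi.add_apply, Pi.smul_apply, smul_eq_mul, lineDensity, dirFun,
      Fin.sum_univ_three]
    ring
  exact ⟨by rw [h1, hdot], by rw [h3, hdot], h2, h4⟩

/-! ## 3. The moments along the heat line (Lemma D) and the heat dissipation -/

variable (A) in
/-- Interval integrability of the continuous profile densities. [ours; bookkeeping] -/
theorem profs_integrable :
    IntervalIntegrable (prof0 A) volume 0 1 ∧ IntervalIntegrable (prof1 A) volume 0 1 ∧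
      IntervalIntegrable (prof2 A) volume 0 1 ∧ IntervalIntegrable (profDD A) volume 0 1 := by
  have hc : ∀ Q : ShearProfile, Continuous (Q : ℝ → ℝ) := fun Q => Q.continuous
  refine ⟨?_, ?_, ?_, ?_⟩ <;> refine Continuous.intervalIntegrable ?_ _ _ <;>
    refine continuous_finsetSum _ fun i _ => ?_
  · exact (hc _).pow 2
  · exact (hc _).mul (hc _)
  · exact (hc _).pow 2
  · exact (hc _).pow 2

/-- **`∫(λ₁⁺)²(u + tΔu) = (m/4)(∫₀¹|A′|² + 2tm ∫₀¹A′·A‴ + t²m² ∫₀¹|A‴|²)`**, both cores. [ours] -/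
theorem topEigMoment_two_line_V (hk : k ≠ 0) (hdiv : ∀ s : ℝ, ∑ i, (k i : ℝ) * (A i).D s = 0) (t : ℝ) :
    torusTopEigMoment 2 (lamV k A + t • Torus.laplacian (lamV k A)) =
        (kR k ⬝ᵥ kR k) / 4 * ((∫ s in (0 : ℝ)..1, prof0 A s) +
          2 * (t * (kR k ⬝ᵥ kR k)) * (∫ s in (0 : ℝ)..1, prof1 A s) +
          (t * (kR k ⬝ᵥ kR k)) ^ 2 * (∫ s in (0 : ℝ)..1, prof2 A s)) ∧
      torusNegBotEigMoment 2 (lamV k A + t • Torus.laplacian (lamV k A)) =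
        (kR k ⬝ᵥ kR k) / 4 * ((∫ s in (0 : ℝ)..1, prof0 A s) +
          2 * (t * (kR k ⬝ᵥ kR k)) * (∫ s in (0 : ℝ)..1, prof1 A s) +
          (t * (kR k ⬝ᵥ kR k)) ^ 2 * (∫ s in (0 : ℝ)..1, prof2 A s)) := by
  obtain ⟨i0, i1, i2, -⟩ := profs_integrable A
  -- Lemma D: `∫_{T³} lineDensity(k·x) dx = ∫₀¹ lineDensity(s) ds`, then linearity
  have hD : ∫ x, lineDensity k A t (dirForm k x) =
      (kR k ⬝ᵥ kR k) / 4 * ((∫ s in (0 : ℝ)..1, prof0 A s) +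
        2 * (t * (kR k ⬝ᵥ kR k)) * (∫ s in (0 : ℝ)..1, prof1 A s) +
        (t * (kR k ⬝ᵥ kR k)) ^ 2 * (∫ s in (0 : ℝ)..1, prof2 A s)) := by
    rw [integral_comp_dirForm hk (continuous_lineDensity (k := k) (A := A) t).aestronglyMeasurable,
      CellularStretching.integral_circle_eq_intervalIntegral]
    simp_rw [lineDensity_coe]
    rw [intervalIntegral.integral_const_mul, intervalIntegral.integral_add (i0.add (i1.const_mul _))
      (i2.const_mul _), intervalIntegral.integral_add i0 (i1.const_mul _),
      intervalIntegral.integral_const_mul, intervalIntegral.integral_const_mul]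
  constructor
  · rw [← hD]
    unfold torusTopEigMoment
    refine integral_congr_ae (ae_of_all _ fun x => ?_)
    obtain ⟨h1, -, h3, -⟩ := lam_sq_line_V hdiv t x
    dsimp only
    rw [← lam_strainFlat, max_eq_left h3, Real.rpow_two, h1]
  · rw [← hD]
    unfold torusNegBotEigMoment
    refine integral_congr_ae (ae_of_all _ fun x => ?_)
    obtain ⟨-, h2, -, h4⟩ := lam_sq_line_V hdiv t x
    dsimp only
    rw [← lam_neg_strainFlat, max_eq_left h4, Real.rpow_two, h2]

variable (A) in
/-- `∫₀¹ A′·A‴ = −∫₀¹ |A″|²` (integration by parts, coordinatewise). [ours] -/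
theorem integral_prof1 : ∫ s in (0 : ℝ)..1, prof1 A s = -∫ s in (0 : ℝ)..1, profDD A s := by
  unfold prof1 profDD
  rw [intervalIntegral.integral_finsetSum (f := fun i s => (A i).D s * (A i).D.D.D s) fun i _ =>
      ((A i).D.continuous.mul (A i).D.D.D.continuous).intervalIntegrable _ _,
    intervalIntegral.integral_finsetSum (f := fun i s => (A i).D.D s ^ 2) fun i _ =>
      ((A i).D.D.continuous.pow 2).intervalIntegrable _ _,
    ← Finset.sum_neg_distrib]
  exact Finset.sum_congr rfl fun i _ => integral_D_mul_DDD (A i)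

variable (A) in
/-- Sharp Wirtinger, coordinatewise: `4π² ∫₀¹|A′|² ≤ ∫₀¹|A″|²`. [ours] -/
theorem wirtinger_prof : 4 * Real.pi ^ 2 * ∫ s in (0 : ℝ)..1, prof0 A s ≤ ∫ s in (0 : ℝ)..1, profDD A s := by
  unfold prof0 profDD
  rw [intervalIntegral.integral_finsetSum (f := fun i s => (A i).D s ^ 2) fun i _ =>
      ((A i).D.continuous.pow 2).intervalIntegrable _ _,
    intervalIntegral.integral_finsetSum (f := fun i s => (A i).D.D s ^ 2) fun i _ =>
      ((A i).D.D.continuous.pow 2).intervalIntegrable _ _,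
    Finset.mul_sum]
  exact Finset.sum_le_sum fun i _ => ProfileWirtinger.wirtinger_D (A i)

/-- **`∫(λ₁⁺)²(u) = ¼|k|² ∫₀¹|A′|²` and `heatDissipation (∫(λ₁⁺)²) u = ½|k|⁴ ∫₀¹|A″|²** (both cores).
[ours] -/
theorem heatDissipation_topEigMoment_two_lamV (hk : k ≠ 0)
    (hdiv : ∀ s : ℝ, ∑ i, (k i : ℝ) * (A i).D s = 0) :
    torusTopEigMoment 2 (lamV k A) = (kR k ⬝ᵥ kR k) / 4 * ∫ s in (0 : ℝ)..1, prof0 A s ∧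
      torusNegBotEigMoment 2 (lamV k A) = (kR k ⬝ᵥ kR k) / 4 * ∫ s in (0 : ℝ)..1, prof0 A s ∧
      heatDissipation (torusTopEigMoment 2) (lamV k A) =
        (kR k ⬝ᵥ kR k) ^ 2 / 2 * ∫ s in (0 : ℝ)..1, profDD A s ∧
      heatDissipation (torusNegBotEigMoment 2) (lamV k A) =
        (kR k ⬝ᵥ kR k) ^ 2 / 2 * ∫ s in (0 : ℝ)..1, profDD A s := by
  have hq : (1 : ℝ) ≤ 2 := by norm_num
  set m := kR k ⬝ᵥ kR k with hm
  set P0 := ∫ s in (0 : ℝ)..1, prof0 A s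
  set P1 := ∫ s in (0 : ℝ)..1, prof1 A s
  set P2 := ∫ s in (0 : ℝ)..1, prof2 A s
  -- the quadratic `g(t) = (m/4)(P0 + 2tm P1 + t²m² P2)` and its derivative at `0` (kept local)
  have hquad : HasDerivAt (fun t : ℝ => m / 4 * (P0 + 2 * (t * m) * P1 + (t * m) ^ 2 * P2))
      (m / 4 * (2 * m * P1)) 0 := by
    have h1 : HasDerivAt (fun t : ℝ => 2 * (t * m) * P1) (2 * m * P1) 0 := by
      have := (((hasDerivAt_id (0 : ℝ)).mul_const m).const_mul 2).mul_const P1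
      simpa using this
    have h2 : HasDerivAt (fun t : ℝ => (t * m) ^ 2 * P2) 0 0 := by
      have := (((hasDerivAt_id (0 : ℝ)).mul_const m).pow 2).mul_const P2
      simpa using this
    have h := (((hasDerivAt_const (0 : ℝ) P0).add h1).add h2).const_mul (m / 4)
    have e : (fun t : ℝ => m / 4 * (P0 + 2 * (t * m) * P1 + (t * m) ^ 2 * P2)) =
        fun t => m / 4 * ((((fun _ : ℝ => P0) + fun t : ℝ => 2 * (t * m) * P1) + fun t : ℝ => (t * m) ^ 2 * P2) t) := by
      funext t; simp only [Pi.add_apply]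
    rw [e]
    exact h.congr_deriv (by ring)
  have h0 := topEigMoment_two_line_V hk hdiv 0
  simp only [zero_smul, zero_mul, mul_zero, add_zero, ne_eq, OfNat.ofNat_ne_zero, not_false_eq_true,
    zero_pow] at h0
  have hval : -(m / 4 * (2 * m * P1)) = m ^ 2 / 2 * ∫ s in (0 : ℝ)..1, profDD A s := by
    simp only [P1, integral_prof1 A]; ring
  refine ⟨h0.1, h0.2, ?_, ?_⟩
  · have e : (fun t : ℝ => torusTopEigMoment 2 (lamV k A + t • Torus.laplacian (lamV k A))) =
        fun t => m / 4 * (P0 + 2 * (t * m) * P1 + (t * m) ^ 2 * P2) :=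
      funext fun t => (topEigMoment_two_line_V hk hdiv t).1
    rw [(heatDissipation_topEigMoment_eq hq (isSmooth_lamV k A)).2, e,
      hquad.hasDerivWithinAt.derivWithin (uniqueDiffWithinAt_Ioi 0), hval]
  · have e : (fun t : ℝ => torusNegBotEigMoment 2 (lamV k A + t • Torus.laplacian (lamV k A))) =
        fun t => m / 4 * (P0 + 2 * (t * m) * P1 + (t * m) ^ 2 * P2) :=
      funext fun t => (topEigMoment_two_line_V hk hdiv t).2
    rw [(heatDissipation_negBotEigMoment_eq hq (isSmooth_lamV k A)).2, e,
      hquad.hasDerivWithinAt.derivWithin (uniqueDiffWithinAt_Ioi 0), hval]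

/-! ## 4. Rigidity -/

/-- **LAMINATE RIGIDITY, general form**: `8π²·|k|²·∫(λ₁⁺)²(u) ≤ heatDissipation (∫(λ₁⁺)²) u` for every
laminate `u = A(k·x)` (`k ≠ 0`, `k·A′ ≡ 0`), i.e. `R₂(u) ≥ 2·4π²|k|²`; the same for the `−λ₃` core.
[ours, calibration] -/
theorem laminate_rigid_two_V (hk : k ≠ 0) (hdiv : ∀ s : ℝ, ∑ i, (k i : ℝ) * (A i).D s = 0) :
    8 * Real.pi ^ 2 * (kR k ⬝ᵥ kR k) * torusTopEigMoment 2 (lamV k A) ≤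
        heatDissipation (torusTopEigMoment 2) (lamV k A) ∧
      8 * Real.pi ^ 2 * (kR k ⬝ᵥ kR k) * torusNegBotEigMoment 2 (lamV k A) ≤
        heatDissipation (torusNegBotEigMoment 2) (lamV k A) := by
  obtain ⟨hT, hB, dT, dB⟩ := heatDissipation_topEigMoment_two_lamV hk hdiv
  have hW := wirtinger_prof A
  have hm : 0 ≤ kR k ⬝ᵥ kR k := dotProduct_self_nonneg' _
  rw [hT, hB, dT, dB]
  have key : 8 * Real.pi ^ 2 * (kR k ⬝ᵥ kR k) * ((kR k ⬝ᵥ kR k) / 4 * ∫ s in (0 : ℝ)..1, prof0 A s) ≤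
      (kR k ⬝ᵥ kR k) ^ 2 / 2 * ∫ s in (0 : ℝ)..1, profDD A s := by
    have : 8 * Real.pi ^ 2 * (kR k ⬝ᵥ kR k) * ((kR k ⬝ᵥ kR k) / 4 * ∫ s in (0 : ℝ)..1, prof0 A s) =
        (kR k ⬝ᵥ kR k) ^ 2 / 2 * (4 * Real.pi ^ 2 * ∫ s in (0 : ℝ)..1, prof0 A s) := by ring
    rw [this]
    exact mul_le_mul_of_nonneg_left hW (by positivity)
  exact ⟨key, key⟩

/-- Hence `8π²·∫(λ₁⁺)²(u) ≤ heatDissipation` (`|k|² ≥ 1`), both cores. [ours, calibration] -/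
theorem laminate_rigid_two_V' (hk : k ≠ 0) (hdiv : ∀ s : ℝ, ∑ i, (k i : ℝ) * (A i).D s = 0) :
    8 * Real.pi ^ 2 * torusTopEigMoment 2 (lamV k A) ≤ heatDissipation (torusTopEigMoment 2) (lamV k A) ∧
      8 * Real.pi ^ 2 * torusNegBotEigMoment 2 (lamV k A) ≤
        heatDissipation (torusNegBotEigMoment 2) (lamV k A) := by
  obtain ⟨h1, h2⟩ := laminate_rigid_two_V hk hdiv
  have hm := one_le_kR_dot k hk
  have hΦ := torusTopEigMoment_nonneg (d := Fin 3) 2 (lamV k A)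
  have hΨ := torusNegBotEigMoment_nonneg (d := Fin 3) 2 (lamV k A)
  have hπ : 0 ≤ 8 * Real.pi ^ 2 := by positivity
  constructor <;> nlinarith [mul_le_mul_of_nonneg_left hm (mul_nonneg hπ hΦ),
    mul_le_mul_of_nonneg_left hm (mul_nonneg hπ hΨ)]

/-- The class of LAMINATES: `v = A(k·x)` for some lattice direction `k ≠ 0` and some smooth periodic
polarisation `A` with `k·A′ ≡ 0`. [ours; bookkeeping] -/
def IsLaminate (v : UnitAddTorus (Fin 3) → EuclideanSpace ℝ (Fin 3)) : Prop :=
  ∃ (k : Fin 3 → ℤ) (A : Fin 3 → ShearProfile), k ≠ 0 ∧ (∀ s : ℝ, ∑ i, (k i : ℝ) * (A i).D s = 0) ∧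
    v = lamV k A

/-- **Lemma L-λ(2) HOLDS on the laminate class at the single-shell rate**:
`HeatCoerciveOn IsLaminate (∫(λ₁⁺)²) (8π²)`. [ours, calibration] -/
theorem heatCoerciveOn_isLaminate_two :
    HeatCoerciveOn (d := Fin 3) IsLaminate (torusTopEigMoment 2) (8 * Real.pi ^ 2) := by
  rintro - v - - - ⟨k, A, hk, hdiv, rfl⟩
  exact (laminate_rigid_two_V' hk hdiv).1

/-- The `−λ₃` core: `HeatCoerciveOn IsLaminate (∫((−λ₃)⁺)²) (8π²)`. [ours, calibration] -/
theorem heatCoerciveOn_isLaminate_two_negBot :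
    HeatCoerciveOn (d := Fin 3) IsLaminate (torusNegBotEigMoment 2) (8 * Real.pi ^ 2) := by
  rintro - v - - - ⟨k, A, hk, hdiv, rfl⟩
  exact (laminate_rigid_two_V' hk hdiv).2

end TopEigLaminate

end Summit.NavierStokesRegularity.FunctionalMining
end
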